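import Literature.Barriers.CriticalPhenomena.LaceExpansionConvolutionBounds
import HarnessLib

/-!
# Hara's convolution lemma (Hara 2008, Lemma 6.1(ii)): `(A⟦·⟧^{2-d} + O(⟦·⟧^{-(d-2+σ)})) * g`

Barrier catalogue `Literature/Barriers/CriticalPhenomena/` (D-0021), second companion file of
`LaceExpansionXSpaceAsymptotics.lean` on the way from Hara's Thm. 1.3 to Cor. 1.4
(`LaceExpansionGaussianLemma.lean`). PROVED here, over the objects of
`LaceExpansionConvolutionBounds.lean`:

* `abs_sum_innerRegion_riesz_le`, `abs_tsum_riesz_diff_mul_le` — the main term: for `d ≥ 3`,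
  `|x| ≥ 4`, even `g` with `|g(y)| ≤ C⟦y⟧^{-(d+ρ)}`, `0 < σ < ρ`, `σ ≤ 1`,
  `|Σ_y (⟦x-y⟧^{2-d} - ⟦x⟧^{2-d}) g(y)| ≤ K|x|^{-(d-2+σ)}` (inner region `|y| ≤ |x|/2`: the odd
  linear Taylor term cancels, the remainder is `O(|y|²|x|^{-d})`; outer region: decay of `g`
  traded for powers of `|x|`, uniform convolution bound);
* `norm_tsum_error_mul_le` — the error term `‖Σ_z e(z) g(x-z)‖ ≤ K|x|^{-(d-2+σ)}` for
  `‖e(z)‖ ≤ B⟦z⟧^{-(d-2+σ)}` (an instance of Lemma 6.1(i), `α = d-2+σ < d < β = d+ρ`);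
* `tsum_conv_riesz_asymptotics` — **Lemma 6.1(ii) in the form needed for Cor. 1.4**: for
  `f : ℤ^d → ℂ` with `‖f(z) - A⟦z⟧^{2-d}‖ ≤ B⟦z⟧^{-(d-2+σ)}` and `g` as above,
  `‖(f*g)(x) - A Σ_y g(y) ⟦x⟧^{2-d}‖ ≤ K⟦x⟧^{-(d-2+σ)}` for all `x`.

Scope, stated plainly: Hara prints (ii) in the sharp form with a single exponent `0 < ρ < 2` for
both the error of `f` and the excess decay of `g` (and `ℤ^d`-symmetric `f, g`); the version proved
here takes the error exponent `σ` strictly below the decay excess `ρ` and at most `1`, which is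
the case of Cor. 1.4 (`σ = (ρ∧2)/d ≤ ρ/3`, `d ≥ 3`) and needs only the evenness of `g`; the sharp
case would in addition require the sharp tail estimate `Σ_{|y|>R}⟦y⟧^{-(d+ρ)} ≍ R^{-ρ}` and is not
proved here.

## References

* T. Hara, Ann. Probab. 36 (2008) 530–593 (arXiv:math-ph/0504021): §1.2.2 (Cor. 1.4), §6
  Lemma 6.1(i)–(ii) [= Hara–van der Hofstad–Slade 2003, Prop. 1.7] and the proof of (iii)–(iv).
-/

noncomputable section

namespace Literature.Barriers.CriticalPhenomena

open MeasureTheory Filter Finset Literature.Probability.LatticeModels Literature.Probability.Percolation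
open scoped Topology BigOperators

variable {d : ℕ}

/-- Bridge between the two pairings of the catalogue: the lattice–lattice pairing `sdot x y` of
`LaceExpansionConvolutionBounds.lean` is the `k`-space pairing `kdot` of
`GaussianDominationRoute.lean` at the real vector of `x` (definitionally). [folklore] -/
theorem sdot_eq_kdot (x y : Site d) : sdot x y = kdot (fun i => ((x i : ℤ) : ℝ)) y := rfl

section MainTerm

variable {g : Site d → ℝ} {C σ ρ : ℝ}

/-- **Inner part of the main term.** For `d ≥ 3`, `|x| ≥ 4`, even `g` with
`|g(y)| ≤ C⟦y⟧^{-(d+ρ)}`, `0 < σ < ρ`, `σ ≤ 1`: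
`|Σ_{|y| ≤ |x|/2} (⟦x-y⟧^{2-d} - ⟦x⟧^{2-d}) g(y)| ≤ K |x|^{-(d-2+σ)}` — subtract the odd linear
term (which sums to zero), bound the rest by `taylor_riesz_bound` and the lattice partial sums.
[cite: Hara2008, Lemma 6.1(ii)] -/
theorem abs_sum_innerRegion_riesz_le (hd : 3 ≤ d) (hg : ∀ y, |g y| ≤ C * jnorm y ^ (-((d : ℝ) + ρ)))
    (hge : ∀ y, g (-y) = g y) (hσ : 0 < σ) (hσρ : σ < ρ) (hσ1 : σ ≤ 1) {x : Site d}
    (hx : 4 ≤ euclidNorm x) :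
    |∑ y ∈ innerRegion x, (jnorm (x - y) ^ (2 - (d : ℝ)) - jnorm x ^ (2 - (d : ℝ))) * g y| ≤
      taylorRieszConst d * C * (1 + 2 * d * 3 ^ (d - 1) * 2 ^ ((d : ℝ) - ((d : ℝ) - 2 + min ρ 1))) *
        euclidNorm x ^ (-((d : ℝ) - 2 + σ)) := by
  have hd2 : 2 ≤ d := by omega
  have hd1 : 1 ≤ d := by omega
  have hdR : (3 : ℝ) ≤ d := by exact_mod_cast hd
  have hC : 0 ≤ C := by
    have h := (abs_nonneg _).trans (hg 0)
    simpa using h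
  set ex := euclidNorm x with hex
  have hex1 : 1 ≤ ex := by linarith
  have hex0 : 0 < ex := by linarith
  have hjx : jnorm x = ex := jnorm_eq_euclidNorm hex1
  set ρ₁ := min ρ 1 with hρ₁
  have hρ₁σ : σ ≤ ρ₁ := le_min hσρ.le hσ1
  have hρ₁ρ : ρ₁ ≤ ρ := min_le_left _ _
  have hρ₁1 : ρ₁ ≤ 1 := min_le_right _ _
  set L : Site d → ℝ := fun y => ((d : ℝ) - 2) * ex ^ (-(d : ℝ)) * sdot x y with hL
  set a : Site d → ℝ := fun y => jnorm (x - y) ^ (2 - (d : ℝ)) - jnorm x ^ (2 - (d : ℝ)) with ha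
  -- subtract the linear term, which sums to zero
  have hlin : ∑ y ∈ innerRegion x, L y * g y = 0 := by
    have h0 := sum_innerRegion_sdot_mul_eq_zero hge x
    calc ∑ y ∈ innerRegion x, L y * g y
        = ((d : ℝ) - 2) * ex ^ (-(d : ℝ)) * ∑ y ∈ innerRegion x, sdot x y * g y := by
          rw [Finset.mul_sum]; refine Finset.sum_congr rfl fun y _ => ?_; simp only [hL]; ring
      _ = 0 := by rw [h0, mul_zero]
  have hsplit : ∑ y ∈ innerRegion x, a y * g y = ∑ y ∈ innerRegion x, (a y - L y) * g y := by
    rw [← sub_zero (∑ y ∈ innerRegion x, a y * g y), ← hlin, ← Finset.sum_sub_distrib]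
    refine Finset.sum_congr rfl fun y _ => by ring
  rw [hsplit]
  -- pointwise Taylor bound on the inner region
  have hpt : ∀ y ∈ innerRegion x, |(a y - L y) * g y| ≤
      taylorRieszConst d * C * ex ^ (-(d : ℝ)) * jnorm y ^ (-((d : ℝ) - 2 + ρ₁)) := by
    intro y hy
    rw [mem_innerRegion] at hy
    have hxy : ex / 2 ≤ euclidNorm (x - y) := by
      have := euclidNorm_sub_euclidNorm_le x y; linarith
    have hjxy : jnorm (x - y) = euclidNorm (x - y) := jnorm_eq_euclidNorm (by linarith)
    have hT := taylor_riesz_bound hd2 (by linarith : 2 ≤ ex) hy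
    have haL : |a y - L y| ≤ taylorRieszConst d * euclidNorm y ^ 2 * ex ^ (-(d : ℝ)) := by
      simp only [ha, hL, hjxy, hjx]; exact hT
    have hjy := jnorm_pos y
    -- `|y|² ⟦y⟧^{-(d+ρ)} ≤ ⟦y⟧^{-(d-2+ρ₁)}`
    have hy2 : euclidNorm y ^ 2 * jnorm y ^ (-((d : ℝ) + ρ)) ≤ jnorm y ^ (-((d : ℝ) - 2 + ρ₁)) := by
      calc euclidNorm y ^ 2 * jnorm y ^ (-((d : ℝ) + ρ))
          ≤ jnorm y ^ 2 * jnorm y ^ (-((d : ℝ) + ρ)) := by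
            gcongr; exact euclidNorm_nonneg y; exact euclidNorm_le_jnorm y
        _ = jnorm y ^ (-((d : ℝ) - 2 + ρ)) := by
            rw [show jnorm y ^ 2 = jnorm y ^ (2 : ℝ) by norm_cast, ← Real.rpow_add hjy]; ring_nf
        _ ≤ jnorm y ^ (-((d : ℝ) - 2 + ρ₁)) :=
            Real.rpow_le_rpow_of_exponent_le (one_le_jnorm y) (by linarith)
    rw [abs_mul]
    calc |a y - L y| * |g y|
        ≤ (taylorRieszConst d * euclidNorm y ^ 2 * ex ^ (-(d : ℝ))) * (C * jnorm y ^ (-((d : ℝ) + ρ))) :=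
          mul_le_mul haL (hg y) (abs_nonneg _) (by
            have := taylorRieszConst_nonneg hd2; positivity)
      _ = taylorRieszConst d * C * ex ^ (-(d : ℝ)) * (euclidNorm y ^ 2 * jnorm y ^ (-((d : ℝ) + ρ))) := by
          ring
      _ ≤ taylorRieszConst d * C * ex ^ (-(d : ℝ)) * jnorm y ^ (-((d : ℝ) - 2 + ρ₁)) := by
          have := taylorRieszConst_nonneg hd2
          gcongr
  -- sum it, enlarge to the box, apply the lattice partial sums
  have hs0 : 0 ≤ (d : ℝ) - 2 + ρ₁ := by linarith
  have hs1 : (d : ℝ) - 2 + ρ₁ ≤ (d : ℝ) - 1 := by linarith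
  have hP := sum_box_ceil_jnorm_rpow_neg_le hd1 hs0 hs1 hex1
  set KP : ℝ := 1 + 2 * d * 3 ^ (d - 1) * 2 ^ ((d : ℝ) - ((d : ℝ) - 2 + ρ₁)) with hKP
  have hKP0 : 0 ≤ KP := by positivity
  have hTC : 0 ≤ taylorRieszConst d * C := mul_nonneg (taylorRieszConst_nonneg hd2) hC
  calc |∑ y ∈ innerRegion x, (a y - L y) * g y|
      ≤ ∑ y ∈ innerRegion x, |(a y - L y) * g y| := Finset.abs_sum_le_sum_abs _ _
    _ ≤ ∑ y ∈ innerRegion x, taylorRieszConst d * C * ex ^ (-(d : ℝ)) * jnorm y ^ (-((d : ℝ) - 2 + ρ₁)) :=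
        Finset.sum_le_sum hpt
    _ = taylorRieszConst d * C * ex ^ (-(d : ℝ)) * ∑ y ∈ innerRegion x, jnorm y ^ (-((d : ℝ) - 2 + ρ₁)) := by
        rw [Finset.mul_sum]
    _ ≤ taylorRieszConst d * C * ex ^ (-(d : ℝ)) *
          ∑ y ∈ box d ⌈ex⌉₊, jnorm y ^ (-((d : ℝ) - 2 + ρ₁)) := by
        gcongr
        · exact fun y _ _ => Real.rpow_nonneg (jnorm_pos y).le _
        · exact innerRegion_subset_box x
    _ ≤ taylorRieszConst d * C * ex ^ (-(d : ℝ)) * (KP * ex ^ ((d : ℝ) - ((d : ℝ) - 2 + ρ₁))) := by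
        gcongr
    _ = taylorRieszConst d * C * KP * (ex ^ (-(d : ℝ)) * ex ^ ((d : ℝ) - ((d : ℝ) - 2 + ρ₁))) := by ring
    _ = taylorRieszConst d * C * KP * ex ^ (-((d : ℝ) - 2 + ρ₁)) := by
        rw [← Real.rpow_add hex0]; ring_nf
    _ ≤ taylorRieszConst d * C * KP * ex ^ (-((d : ℝ) - 2 + σ)) := by
        gcongr

end MainTerm


section MainTerm

variable {g : Site d → ℝ} {C σ ρ : ℝ}

/-- **The main term of Lemma 6.1(ii).** For `d ≥ 3`, `|x| ≥ 4`, even `g` with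
`|g(y)| ≤ C⟦y⟧^{-(d+ρ)}`, `0 < σ < ρ`, `σ ≤ 1`:
`|Σ_y (⟦x-y⟧^{2-d} - ⟦x⟧^{2-d}) g(y)| ≤ K |x|^{-(d-2+σ)}`, with the inner region handled by
`abs_sum_innerRegion_riesz_le` and the outer region `|y| > |x|/2` by trading the decay of `g`
for powers of `|x|` and the uniform convolution bound. [cite: Hara2008, Lemma 6.1(ii)] -/
theorem abs_tsum_riesz_diff_mul_le (hd : 3 ≤ d) (hg : ∀ y, |g y| ≤ C * jnorm y ^ (-((d : ℝ) + ρ)))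
    (hge : ∀ y, g (-y) = g y) (hσ : 0 < σ) (hσρ : σ < ρ) (hσ1 : σ ≤ 1) {x : Site d}
    (hx : 4 ≤ euclidNorm x) :
    Summable (fun y => (jnorm (x - y) ^ (2 - (d : ℝ)) - jnorm x ^ (2 - (d : ℝ))) * g y) ∧
    |∑' y, (jnorm (x - y) ^ (2 - (d : ℝ)) - jnorm x ^ (2 - (d : ℝ))) * g y| ≤
      (taylorRieszConst d * C * (1 + 2 * d * 3 ^ (d - 1) * 2 ^ ((d : ℝ) - ((d : ℝ) - 2 + min ρ 1))) +
        C * (2 ^ σ + 2 * 2 ^ ((d : ℝ) - 2 + σ)) * ∑' z : Site d, jnorm z ^ (-((d : ℝ) + ρ - σ))) *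
        euclidNorm x ^ (-((d : ℝ) - 2 + σ)) := by
  classical
  have hd2 : 2 ≤ d := by omega
  have hdR : (3 : ℝ) ≤ d := by exact_mod_cast hd
  have hC : 0 ≤ C := by simpa using (abs_nonneg _).trans (hg 0)
  set ex := euclidNorm x with hex
  have hex1 : 1 ≤ ex := by linarith
  have hex0 : 0 < ex := by linarith
  have hjx : jnorm x = ex := jnorm_eq_euclidNorm hex1
  set r := ex / 2 with hr
  have hr0 : 0 < r := by positivity
  set a : Site d → ℝ := fun y => jnorm (x - y) ^ (2 - (d : ℝ)) - jnorm x ^ (2 - (d : ℝ)) with ha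
  set R1 := innerRegion x with hR1
  -- summability of `a g`
  have hgs : Summable fun y => |g y| := summable_abs_of_le_jnorm_rpow_neg hg (by linarith)
  have ha_bd : ∀ y, |a y| ≤ 2 := fun y => by
    have h1 := jnorm_rpow_two_sub_le_one hd2 (x - y)
    have h2 := jnorm_rpow_two_sub_le_one hd2 x
    have h1' := Real.rpow_nonneg (jnorm_pos (x - y)).le (2 - (d : ℝ))
    have h2' := Real.rpow_nonneg (jnorm_pos x).le (2 - (d : ℝ))
    simp only [ha]; rw [abs_le]; constructor <;> linarith
  have hags : Summable fun y => a y * g y := by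
    refine Summable.of_norm_bounded (hgs.mul_left 2) fun y => ?_
    rw [Real.norm_eq_abs, abs_mul]
    exact mul_le_mul_of_nonneg_right (ha_bd y) (abs_nonneg _)
  refine ⟨hags, ?_⟩
  -- split into the inner sum and the outer series
  set u : Site d → ℝ := fun y => if y ∈ R1 then a y * g y else 0 with hu
  set t : Site d → ℝ := fun y => if y ∈ R1 then 0 else a y * g y with ht
  have hut : ∀ y, a y * g y = u y + t y := fun y => by
    simp only [hu, ht]; split_ifs <;> simp
  have hus : Summable u := summable_of_ne_finset_zero (s := R1) fun y hy => by simp [hu, hy]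
  have hts : Summable t := by
    have : t = fun y => a y * g y - u y := funext fun y => by rw [hut y]; ring
    rw [this]; exact hags.sub hus
  have hu_sum : ∑' y, u y = ∑ y ∈ R1, a y * g y := by
    rw [tsum_eq_sum (s := R1) (fun y hy => by simp [hu, hy])]
    exact Finset.sum_congr rfl fun y hy => by simp [hu, hy]
  have hsplit : ∑' y, a y * g y = ∑ y ∈ R1, a y * g y + ∑' y, t y := by
    rw [tsum_congr hut, Summable.tsum_add hus hts, hu_sum]
  -- the outer series: pointwise domination
  set Z := ∑' z : Site d, jnorm z ^ (-((d : ℝ) + ρ - σ)) with hZ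
  have hZs : Summable fun z : Site d => jnorm z ^ (-((d : ℝ) + ρ - σ)) :=
    summable_jnorm_rpow_neg (by linarith)
  have hZ0 : 0 ≤ Z := tsum_nonneg fun z => Real.rpow_nonneg (jnorm_pos z).le _
  obtain ⟨hWs, hW⟩ := summable_jnorm_conv (d := d) (α := (d : ℝ) - 2) (β := 2 + ρ - σ)
    (by linarith) (by linarith) (by linarith) x
  have hW' : ∑' y, jnorm (x - y) ^ (-((d : ℝ) - 2)) * jnorm y ^ (-(2 + ρ - σ)) ≤ 2 * Z := by
    refine hW.trans (le_of_eq ?_); rw [hZ]; congr 1; refine tsum_congr fun z => ?_; ring_nf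
  set c₁ := C * r ^ (-σ) * ex ^ (2 - (d : ℝ)) with hc₁
  set c₂ := C * r ^ (-((d : ℝ) - 2 + σ)) with hc₂
  have hc₁0 : 0 ≤ c₁ := by positivity
  have hc₂0 : 0 ≤ c₂ := by positivity
  set h : Site d → ℝ := fun y => c₁ * jnorm y ^ (-((d : ℝ) + ρ - σ)) +
    c₂ * (jnorm (x - y) ^ (-((d : ℝ) - 2)) * jnorm y ^ (-(2 + ρ - σ))) with hh
  have hhs : Summable h := (hZs.mul_left c₁).add (hWs.mul_left c₂)
  have hdom : ∀ y, ‖t y‖ ≤ h y := by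
    intro y
    have hh0 : 0 ≤ h y := by
      simp only [hh]
      have := Real.rpow_nonneg (jnorm_pos y).le (-((d : ℝ) + ρ - σ))
      have := Real.rpow_nonneg (jnorm_pos y).le (-(2 + ρ - σ))
      have := Real.rpow_nonneg (jnorm_pos (x - y)).le (-((d : ℝ) - 2))
      positivity
    by_cases hy : y ∈ R1
    · simp only [ht, if_pos hy, norm_zero]; exact hh0
    simp only [ht, if_neg hy, Real.norm_eq_abs, abs_mul]
    have hyr : r ≤ jnorm y :=
      (lt_euclidNorm_of_not_mem_innerRegion hy).le.trans (euclidNorm_le_jnorm y)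
    have hjy := jnorm_pos y
    have hjxy := jnorm_pos (x - y)
    -- the two pieces
    have hp1 : jnorm x ^ (2 - (d : ℝ)) * (C * jnorm y ^ (-((d : ℝ) + ρ))) ≤
        c₁ * jnorm y ^ (-((d : ℝ) + ρ - σ)) := by
      have hsplit' : jnorm y ^ (-((d : ℝ) + ρ)) = jnorm y ^ (-σ) * jnorm y ^ (-((d : ℝ) + ρ - σ)) := by
        rw [← Real.rpow_add hjy]; ring_nf
      have hyσ : jnorm y ^ (-σ) ≤ r ^ (-σ) := Real.rpow_le_rpow_of_nonpos hr0 hyr (by linarith)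
      rw [hsplit', hjx, hc₁]
      have := Real.rpow_nonneg hjy.le (-((d : ℝ) + ρ - σ))
      have := Real.rpow_nonneg hex0.le (2 - (d : ℝ))
      calc ex ^ (2 - (d : ℝ)) * (C * (jnorm y ^ (-σ) * jnorm y ^ (-((d : ℝ) + ρ - σ))))
          ≤ ex ^ (2 - (d : ℝ)) * (C * (r ^ (-σ) * jnorm y ^ (-((d : ℝ) + ρ - σ)))) := by gcongr
        _ = C * r ^ (-σ) * ex ^ (2 - (d : ℝ)) * jnorm y ^ (-((d : ℝ) + ρ - σ)) := by ring
    have hp2 : jnorm (x - y) ^ (2 - (d : ℝ)) * (C * jnorm y ^ (-((d : ℝ) + ρ))) ≤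
        c₂ * (jnorm (x - y) ^ (-((d : ℝ) - 2)) * jnorm y ^ (-(2 + ρ - σ))) := by
      have hsplit' : jnorm y ^ (-((d : ℝ) + ρ)) =
          jnorm y ^ (-((d : ℝ) - 2 + σ)) * jnorm y ^ (-(2 + ρ - σ)) := by
        rw [← Real.rpow_add hjy]; ring_nf
      have hyσ : jnorm y ^ (-((d : ℝ) - 2 + σ)) ≤ r ^ (-((d : ℝ) - 2 + σ)) :=
        Real.rpow_le_rpow_of_nonpos hr0 hyr (by linarith)
      have he : jnorm (x - y) ^ (2 - (d : ℝ)) = jnorm (x - y) ^ (-((d : ℝ) - 2)) := by ring_nf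
      rw [hsplit', he, hc₂]
      have := Real.rpow_nonneg hjy.le (-(2 + ρ - σ))
      have := Real.rpow_nonneg hjxy.le (-((d : ℝ) - 2))
      calc jnorm (x - y) ^ (-((d : ℝ) - 2)) * (C * (jnorm y ^ (-((d : ℝ) - 2 + σ)) * jnorm y ^ (-(2 + ρ - σ))))
          ≤ jnorm (x - y) ^ (-((d : ℝ) - 2)) * (C * (r ^ (-((d : ℝ) - 2 + σ)) * jnorm y ^ (-(2 + ρ - σ)))) := by
            gcongr
        _ = C * r ^ (-((d : ℝ) - 2 + σ)) * (jnorm (x - y) ^ (-((d : ℝ) - 2)) * jnorm y ^ (-(2 + ρ - σ))) := by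
            ring
    have ha' : |a y| ≤ jnorm (x - y) ^ (2 - (d : ℝ)) + jnorm x ^ (2 - (d : ℝ)) := by
      simp only [ha]
      have h1' := Real.rpow_nonneg hjxy.le (2 - (d : ℝ))
      have h2' := Real.rpow_nonneg (jnorm_pos x).le (2 - (d : ℝ))
      rw [abs_le]; constructor <;> linarith
    calc |a y| * |g y| ≤ (jnorm (x - y) ^ (2 - (d : ℝ)) + jnorm x ^ (2 - (d : ℝ))) *
          (C * jnorm y ^ (-((d : ℝ) + ρ))) :=
          mul_le_mul ha' (hg y) (abs_nonneg _) (add_nonneg (Real.rpow_nonneg hjxy.le _)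
            (Real.rpow_nonneg (jnorm_pos x).le _))
      _ = jnorm (x - y) ^ (2 - (d : ℝ)) * (C * jnorm y ^ (-((d : ℝ) + ρ))) +
            jnorm x ^ (2 - (d : ℝ)) * (C * jnorm y ^ (-((d : ℝ) + ρ))) := by ring
      _ ≤ c₂ * (jnorm (x - y) ^ (-((d : ℝ) - 2)) * jnorm y ^ (-(2 + ρ - σ))) +
            c₁ * jnorm y ^ (-((d : ℝ) + ρ - σ)) := add_le_add hp2 hp1
      _ = h y := by simp only [hh]; ring
  have hout : ‖∑' y, t y‖ ≤ c₁ * Z + c₂ * (2 * Z) := by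
    refine (tsum_of_norm_bounded hhs.hasSum hdom).trans ?_
    simp only [hh]
    rw [Summable.tsum_add (hZs.mul_left c₁) (hWs.mul_left c₂), tsum_mul_left, tsum_mul_left]
    gcongr
  -- the constants in terms of `|x|`
  have hr_pow : ∀ s : ℝ, r ^ (-s) = 2 ^ s * ex ^ (-s) := fun s => by
    rw [hr, Real.div_rpow hex0.le (by norm_num), Real.rpow_neg (by norm_num : (0:ℝ) ≤ 2),
      div_eq_mul_inv, inv_inv, mul_comm]
  have hc₁' : c₁ = C * 2 ^ σ * ex ^ (-((d : ℝ) - 2 + σ)) := by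
    rw [hc₁, hr_pow, show ex ^ (2 - (d : ℝ)) = ex ^ (-((d : ℝ) - 2)) by ring_nf, mul_assoc, mul_assoc,
      ← Real.rpow_add hex0]
    ring_nf
  have hc₂' : c₂ = C * 2 ^ ((d : ℝ) - 2 + σ) * ex ^ (-((d : ℝ) - 2 + σ)) := by
    rw [hc₂, hr_pow]; ring
  have hinner := abs_sum_innerRegion_riesz_le hd hg hge hσ hσρ hσ1 hx
  rw [Real.norm_eq_abs] at hout
  rw [hsplit]
  calc |∑ y ∈ R1, a y * g y + ∑' y, t y| ≤ |∑ y ∈ R1, a y * g y| + |∑' y, t y| := abs_add_le _ _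
    _ ≤ taylorRieszConst d * C * (1 + 2 * d * 3 ^ (d - 1) * 2 ^ ((d : ℝ) - ((d : ℝ) - 2 + min ρ 1))) *
          ex ^ (-((d : ℝ) - 2 + σ)) + (c₁ * Z + c₂ * (2 * Z)) := add_le_add hinner hout
    _ = _ := by rw [hc₁', hc₂']; ring

end MainTerm


section ErrorTerm

variable {g : Site d → ℝ} {C σ ρ : ℝ}

/-- **The error term of Lemma 6.1(ii)** (an instance of Lemma 6.1(i), `α = d-2+σ < d < β = d+ρ`):
for `d ≥ 3`, `|x| ≥ 4`, `‖e(z)‖ ≤ B⟦z⟧^{-(d-2+σ)}`, `|g(y)| ≤ C⟦y⟧^{-(d+ρ)}`, `0 < σ < ρ`, `σ ≤ 1`: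
`‖Σ_z e(z) g(x-z)‖ ≤ K |x|^{-(d-2+σ)}` (inner region: decay of `g(x-z)` and the lattice partial
sums of `⟦z⟧^{-(d-2+σ)}`; outer region: decay of `e` and `Σ|g| < ∞`).
[cite: Hara2008, Lemma 6.1(i)–(ii)] -/
theorem norm_tsum_error_mul_le (hd : 3 ≤ d) {e : Site d → ℂ} {B : ℝ}
    (he : ∀ z, ‖e z‖ ≤ B * jnorm z ^ (-((d : ℝ) - 2 + σ)))
    (hg : ∀ y, |g y| ≤ C * jnorm y ^ (-((d : ℝ) + ρ))) (hσ : 0 < σ) (hσρ : σ < ρ) (hσ1 : σ ≤ 1)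
    {x : Site d} (hx : 4 ≤ euclidNorm x) :
    Summable (fun z => e z * (g (x - z) : ℂ)) ∧
    ‖∑' z, e z * (g (x - z) : ℂ)‖ ≤
      (B * C * 2 ^ ((d : ℝ) + ρ) * (1 + 2 * d * 3 ^ (d - 1) * 2 ^ ((d : ℝ) - ((d : ℝ) - 2 + σ))) +
        B * C * 2 ^ ((d : ℝ) - 2 + σ) * ∑' z : Site d, jnorm z ^ (-((d : ℝ) + ρ))) *
        euclidNorm x ^ (-((d : ℝ) - 2 + σ)) := by
  classical
  have hd2 : 2 ≤ d := by omega
  have hd1 : 1 ≤ d := by omega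
  have hdR : (3 : ℝ) ≤ d := by exact_mod_cast hd
  have hC : 0 ≤ C := by simpa using (abs_nonneg _).trans (hg 0)
  have hB : 0 ≤ B := by simpa using (norm_nonneg _).trans (he 0)
  have hρ : 0 < ρ := by linarith
  set ex := euclidNorm x with hex
  have hex1 : 1 ≤ ex := by linarith
  have hex0 : 0 < ex := by linarith
  set r := ex / 2 with hr
  have hr0 : 0 < r := by positivity
  set R1 := innerRegion x with hR1
  -- summability
  have hgs : Summable fun y => |g y| := summable_abs_of_le_jnorm_rpow_neg hg hρ
  have hgs' : Summable fun z => |g (x - z)| := summable_comp_sub_left hgs x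
  have he1 : ∀ z, ‖e z‖ ≤ B := fun z => (he z).trans (by
    have := Real.rpow_le_one_of_one_le_of_nonpos (one_le_jnorm z) (by linarith : -((d : ℝ) - 2 + σ) ≤ 0)
    nlinarith)
  have hFs : Summable fun z => e z * (g (x - z) : ℂ) := by
    refine Summable.of_norm_bounded (hgs'.mul_left B) fun z => ?_
    rw [norm_mul, Complex.norm_real, Real.norm_eq_abs]
    exact mul_le_mul_of_nonneg_right (he1 z) (abs_nonneg _)
  refine ⟨hFs, ?_⟩
  set F : Site d → ℂ := fun z => e z * (g (x - z) : ℂ) with hF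
  set u : Site d → ℂ := fun z => if z ∈ R1 then F z else 0 with hu
  set t : Site d → ℂ := fun z => if z ∈ R1 then 0 else F z with ht
  have hut : ∀ z, F z = u z + t z := fun z => by simp only [hu, ht]; split_ifs <;> simp
  have hus : Summable u := summable_of_ne_finset_zero (s := R1) fun z hz => by simp [hu, hz]
  have hts : Summable t := by
    have : t = fun z => F z - u z := funext fun z => by rw [hut z]; ring
    rw [this]; exact hFs.sub hus
  have hu_sum : ∑' z, u z = ∑ z ∈ R1, F z := by
    rw [tsum_eq_sum (s := R1) (fun z hz => by simp [hu, hz])]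
    exact Finset.sum_congr rfl fun z hz => by simp [hu, hz]
  have hsplit : ∑' z, F z = ∑ z ∈ R1, F z + ∑' z, t z := by
    rw [tsum_congr hut, Summable.tsum_add hus hts, hu_sum]
  -- inner region
  have hs0 : 0 ≤ (d : ℝ) - 2 + σ := by linarith
  have hs1 : (d : ℝ) - 2 + σ ≤ (d : ℝ) - 1 := by linarith
  set KP : ℝ := 1 + 2 * d * 3 ^ (d - 1) * 2 ^ ((d : ℝ) - ((d : ℝ) - 2 + σ)) with hKP
  have hP := sum_box_ceil_jnorm_rpow_neg_le hd1 hs0 hs1 hex1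
  have hin_pt : ∀ z ∈ R1, ‖F z‖ ≤ B * C * r ^ (-((d : ℝ) + ρ)) * jnorm z ^ (-((d : ℝ) - 2 + σ)) := by
    intro z hz
    rw [hR1, mem_innerRegion] at hz
    have hxz : r ≤ jnorm (x - z) := by
      have := euclidNorm_sub_euclidNorm_le x z
      exact le_trans (by linarith) (euclidNorm_le_jnorm (x - z))
    have hgz : |g (x - z)| ≤ C * r ^ (-((d : ℝ) + ρ)) :=
      (hg (x - z)).trans (mul_le_mul_of_nonneg_left
        (Real.rpow_le_rpow_of_nonpos hr0 hxz (by linarith)) hC)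
    simp only [hF]; rw [norm_mul, Complex.norm_real, Real.norm_eq_abs]
    calc ‖e z‖ * |g (x - z)| ≤ (B * jnorm z ^ (-((d : ℝ) - 2 + σ))) * (C * r ^ (-((d : ℝ) + ρ))) :=
          mul_le_mul (he z) hgz (abs_nonneg _) (mul_nonneg hB (Real.rpow_nonneg (jnorm_pos z).le _))
      _ = _ := by ring
  have hin : ‖∑ z ∈ R1, F z‖ ≤ B * C * r ^ (-((d : ℝ) + ρ)) * (KP * ex ^ ((d : ℝ) - ((d : ℝ) - 2 + σ))) := by
    calc ‖∑ z ∈ R1, F z‖ ≤ ∑ z ∈ R1, ‖F z‖ := norm_sum_le _ _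
      _ ≤ ∑ z ∈ R1, B * C * r ^ (-((d : ℝ) + ρ)) * jnorm z ^ (-((d : ℝ) - 2 + σ)) := Finset.sum_le_sum hin_pt
      _ = B * C * r ^ (-((d : ℝ) + ρ)) * ∑ z ∈ R1, jnorm z ^ (-((d : ℝ) - 2 + σ)) := by rw [Finset.mul_sum]
      _ ≤ B * C * r ^ (-((d : ℝ) + ρ)) * ∑ z ∈ box d ⌈ex⌉₊, jnorm z ^ (-((d : ℝ) - 2 + σ)) := by
          gcongr
          · exact fun z _ _ => Real.rpow_nonneg (jnorm_pos z).le _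
          · exact innerRegion_subset_box x
      _ ≤ B * C * r ^ (-((d : ℝ) + ρ)) * (KP * ex ^ ((d : ℝ) - ((d : ℝ) - 2 + σ))) := by gcongr
  -- outer region
  set Z₂ := ∑' z : Site d, jnorm z ^ (-((d : ℝ) + ρ)) with hZ₂
  have hZ₂s : Summable fun z : Site d => jnorm z ^ (-((d : ℝ) + ρ)) := summable_jnorm_rpow_neg (by linarith)
  have hZ₂s' : Summable fun z : Site d => jnorm (x - z) ^ (-((d : ℝ) + ρ)) := summable_comp_sub_left hZ₂s x
  have hZ₂0 : 0 ≤ Z₂ := tsum_nonneg fun z => Real.rpow_nonneg (jnorm_pos z).le _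
  set h : Site d → ℝ := fun z => B * r ^ (-((d : ℝ) - 2 + σ)) * C * jnorm (x - z) ^ (-((d : ℝ) + ρ)) with hh
  have hhs : Summable h := hZ₂s'.mul_left _
  have hdom : ∀ z, ‖t z‖ ≤ h z := by
    intro z
    have hh0 : 0 ≤ h z := by
      simp only [hh]; have := Real.rpow_nonneg (jnorm_pos (x - z)).le (-((d : ℝ) + ρ)); positivity
    by_cases hz : z ∈ R1
    · simp only [ht, if_pos hz, norm_zero]; exact hh0
    simp only [ht, if_neg hz, hF]
    rw [norm_mul, Complex.norm_real, Real.norm_eq_abs]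
    have hzr : r ≤ jnorm z :=
      (lt_euclidNorm_of_not_mem_innerRegion hz).le.trans (euclidNorm_le_jnorm z)
    have hez : ‖e z‖ ≤ B * r ^ (-((d : ℝ) - 2 + σ)) :=
      (he z).trans (mul_le_mul_of_nonneg_left (Real.rpow_le_rpow_of_nonpos hr0 hzr (by linarith)) hB)
    calc ‖e z‖ * |g (x - z)| ≤ (B * r ^ (-((d : ℝ) - 2 + σ))) * (C * jnorm (x - z) ^ (-((d : ℝ) + ρ))) :=
          mul_le_mul hez (hg (x - z)) (abs_nonneg _) (mul_nonneg hB (Real.rpow_nonneg hr0.le _))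
      _ = h z := by simp only [hh]; ring
  have hout : ‖∑' z, t z‖ ≤ B * r ^ (-((d : ℝ) - 2 + σ)) * C * Z₂ := by
    refine (tsum_of_norm_bounded hhs.hasSum hdom).trans (le_of_eq ?_)
    simp only [hh]
    rw [tsum_mul_left, tsum_comp_sub_left (fun z => jnorm z ^ (-((d : ℝ) + ρ))) x]
  -- constants in terms of `|x|`
  have hr_pow : ∀ s : ℝ, r ^ (-s) = 2 ^ s * ex ^ (-s) := fun s => by
    rw [hr, Real.div_rpow hex0.le (by norm_num), Real.rpow_neg (by norm_num : (0:ℝ) ≤ 2),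
      div_eq_mul_inv, inv_inv, mul_comm]
  have hin' : B * C * r ^ (-((d : ℝ) + ρ)) * (KP * ex ^ ((d : ℝ) - ((d : ℝ) - 2 + σ))) ≤
      B * C * 2 ^ ((d : ℝ) + ρ) * KP * ex ^ (-((d : ℝ) - 2 + σ)) := by
    rw [hr_pow]
    have hcomb : ex ^ (-((d : ℝ) + ρ)) * ex ^ ((d : ℝ) - ((d : ℝ) - 2 + σ)) =
        ex ^ (-((d : ℝ) - 2 + σ)) * ex ^ (-ρ) := by
      rw [← Real.rpow_add hex0, ← Real.rpow_add hex0]; ring_nf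
    have hρ1 : ex ^ (-ρ) ≤ 1 := Real.rpow_le_one_of_one_le_of_nonpos hex1 (by linarith)
    have hKP0 : 0 ≤ KP := by positivity
    calc B * C * (2 ^ ((d : ℝ) + ρ) * ex ^ (-((d : ℝ) + ρ))) * (KP * ex ^ ((d : ℝ) - ((d : ℝ) - 2 + σ)))
        = B * C * 2 ^ ((d : ℝ) + ρ) * KP * (ex ^ (-((d : ℝ) + ρ)) * ex ^ ((d : ℝ) - ((d : ℝ) - 2 + σ))) := by
          ring
      _ = B * C * 2 ^ ((d : ℝ) + ρ) * KP * ex ^ (-((d : ℝ) - 2 + σ)) * ex ^ (-ρ) := by rw [hcomb]; ring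
      _ ≤ B * C * 2 ^ ((d : ℝ) + ρ) * KP * ex ^ (-((d : ℝ) - 2 + σ)) * 1 := by gcongr
      _ = _ := by ring
  have hout' : B * r ^ (-((d : ℝ) - 2 + σ)) * C * Z₂ =
      B * C * 2 ^ ((d : ℝ) - 2 + σ) * Z₂ * ex ^ (-((d : ℝ) - 2 + σ)) := by
    rw [hr_pow]; ring
  change ‖∑' z, F z‖ ≤ _
  rw [hsplit]
  calc ‖∑ z ∈ R1, F z + ∑' z, t z‖ ≤ ‖∑ z ∈ R1, F z‖ + ‖∑' z, t z‖ := norm_add_le _ _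
    _ ≤ B * C * 2 ^ ((d : ℝ) + ρ) * KP * ex ^ (-((d : ℝ) - 2 + σ)) +
          B * C * 2 ^ ((d : ℝ) - 2 + σ) * Z₂ * ex ^ (-((d : ℝ) - 2 + σ)) :=
        add_le_add (hin.trans hin') (hout.trans (le_of_eq hout'))
    _ = _ := by ring

end ErrorTerm


/-! ### Lemma 6.1(ii): convolution of a Riesz-type asymptotic with a decaying symmetric function -/

/-- **Hara 2008, Lemma 6.1(ii) (= Hara–van der Hofstad–Slade 2003, Prop. 1.7(ii)), in the form
needed for Cor. 1.4.** Let `d ≥ 3`, `f : ℤ^d → ℂ` with `f(z) = A⟦z⟧^{2-d} + O(⟦z⟧^{-(d-2+σ)})`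
(uniformly: `‖f(z) - A⟦z⟧^{2-d}‖ ≤ B⟦z⟧^{-(d-2+σ)}` for all `z`), and `g : ℤ^d → ℝ` even with
`|g(y)| ≤ C⟦y⟧^{-(d+ρ)}`, where `0 < σ < ρ` and `σ ≤ 1`. Then
`(f*g)(x) = A Σ_y g(y) ⟦x⟧^{2-d} + O(⟦x⟧^{-(d-2+σ)})`, uniformly in `x`.
Hara's printed (ii) is the sharp case (one exponent `0 < ρ < 2` for both the error of `f` and the
excess decay of `g`, `ℤ^d`-symmetric `f, g`); here the error exponent `σ` is strictly below the decay
excess `ρ` of `g` and at most `1` — exactly the situation of Cor. 1.4, where `σ = (ρ ∧ 2)/d ≤ ρ/3` —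
which lets the tail `Σ_{|y|>|x|/2}|g(y)|` be bounded crudely and the inner lattice sums by
`sum_box_jnorm_rpow_neg_le`; only the evenness of `g` is used (to cancel the linear Taylor term,
`sum_innerRegion_sdot_mul_eq_zero`). [cite: Hara2008, Lemma 6.1(ii)] -/
theorem tsum_conv_riesz_asymptotics (hd : 3 ≤ d) {f : Site d → ℂ} {g : Site d → ℝ} {A : ℂ}
    {B C σ ρ : ℝ}
    (hf : ∀ z, ‖f z - A * ((jnorm z ^ (2 - (d : ℝ)) : ℝ) : ℂ)‖ ≤ B * jnorm z ^ (-((d : ℝ) - 2 + σ)))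
    (hg : ∀ y, |g y| ≤ C * jnorm y ^ (-((d : ℝ) + ρ)))
    (hge : ∀ y, g (-y) = g y) (hσ : 0 < σ) (hσρ : σ < ρ) (hσ1 : σ ≤ 1) :
    ∃ K : ℝ, ∀ x : Site d,
      Summable (fun y => f (x - y) * (g y : ℂ)) ∧
      ‖∑' y, f (x - y) * (g y : ℂ) - A * ((∑' y, g y : ℝ) : ℂ) * ((jnorm x ^ (2 - (d : ℝ)) : ℝ) : ℂ)‖ ≤
        K * jnorm x ^ (-((d : ℝ) - 2 + σ)) := by
  classical
  have hd2 : 2 ≤ d := by omega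
  have hdR : (3 : ℝ) ≤ d := by exact_mod_cast hd
  have hC : 0 ≤ C := by simpa using (abs_nonneg _).trans (hg 0)
  have hρ : 0 < ρ := by linarith
  set e : Site d → ℂ := fun z => f z - A * ((jnorm z ^ (2 - (d : ℝ)) : ℝ) : ℂ) with he_def
  have he : ∀ z, ‖e z‖ ≤ B * jnorm z ^ (-((d : ℝ) - 2 + σ)) := hf
  have hB : 0 ≤ B := by simpa using (norm_nonneg _).trans (he 0)
  -- a uniform bound on `f`
  have hf_bd : ∀ z, ‖f z‖ ≤ ‖A‖ + B := by
    intro z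
    have h1 : ‖A * ((jnorm z ^ (2 - (d : ℝ)) : ℝ) : ℂ)‖ ≤ ‖A‖ := by
      rw [norm_mul, Complex.norm_real, Real.norm_eq_abs,
        abs_of_nonneg (Real.rpow_nonneg (jnorm_pos z).le _)]
      exact mul_le_of_le_one_right (norm_nonneg A) (jnorm_rpow_two_sub_le_one hd2 z)
    have h2 : ‖e z‖ ≤ B := (he z).trans (by
      have := Real.rpow_le_one_of_one_le_of_nonpos (one_le_jnorm z) (by linarith : -((d : ℝ) - 2 + σ) ≤ 0)
      nlinarith)
    calc ‖f z‖ = ‖A * ((jnorm z ^ (2 - (d : ℝ)) : ℝ) : ℂ) + e z‖ := by simp [he_def]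
      _ ≤ ‖A * ((jnorm z ^ (2 - (d : ℝ)) : ℝ) : ℂ)‖ + ‖e z‖ := norm_add_le _ _
      _ ≤ ‖A‖ + B := add_le_add h1 h2
  have hgs : Summable fun y => |g y| := summable_abs_of_le_jnorm_rpow_neg hg hρ
  -- the constants
  set Z₂ := ∑' z : Site d, jnorm z ^ (-((d : ℝ) + ρ)) with hZ₂
  have hZ₂s : Summable fun z : Site d => jnorm z ^ (-((d : ℝ) + ρ)) := summable_jnorm_rpow_neg (by linarith)
  have hZ₂0 : 0 ≤ Z₂ := tsum_nonneg fun z => Real.rpow_nonneg (jnorm_pos z).le _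
  have hG : ∑' y, |g y| ≤ C * Z₂ := by
    rw [hZ₂, ← tsum_mul_left]; exact Summable.tsum_le_tsum hg hgs (hZ₂s.mul_left C)
  set KM : ℝ := taylorRieszConst d * C * (1 + 2 * d * 3 ^ (d - 1) * 2 ^ ((d : ℝ) - ((d : ℝ) - 2 + min ρ 1))) +
      C * (2 ^ σ + 2 * 2 ^ ((d : ℝ) - 2 + σ)) * ∑' z : Site d, jnorm z ^ (-((d : ℝ) + ρ - σ)) with hKM
  set KE : ℝ := B * C * 2 ^ ((d : ℝ) + ρ) * (1 + 2 * d * 3 ^ (d - 1) * 2 ^ ((d : ℝ) - ((d : ℝ) - 2 + σ))) +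
      B * C * 2 ^ ((d : ℝ) - 2 + σ) * Z₂ with hKE
  set D₀ : ℝ := (‖A‖ + B) * (C * Z₂) + ‖A‖ * (C * Z₂) with hD₀
  refine ⟨max (D₀ * 4 ^ ((d : ℝ) - 2 + σ)) (‖A‖ * KM + KE), fun x => ?_⟩
  -- summability of the convolution
  have hconv_s : Summable fun y => f (x - y) * (g y : ℂ) := by
    refine Summable.of_norm_bounded (hgs.mul_left (‖A‖ + B)) fun y => ?_
    rw [norm_mul, Complex.norm_real, Real.norm_eq_abs]
    exact mul_le_mul_of_nonneg_right (hf_bd _) (abs_nonneg _)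
  refine ⟨hconv_s, ?_⟩
  have hconv_bd : ‖∑' y, f (x - y) * (g y : ℂ)‖ ≤ (‖A‖ + B) * (C * Z₂) := by
    refine (tsum_of_norm_bounded (hgs.mul_left (‖A‖ + B)).hasSum fun y => ?_).trans ?_
    · rw [norm_mul, Complex.norm_real, Real.norm_eq_abs]
      exact mul_le_mul_of_nonneg_right (hf_bd _) (abs_nonneg _)
    · rw [tsum_mul_left]; gcongr
  by_cases hx : euclidNorm x < 4
  · -- small `x`: crude bound
    have hjx4 : jnorm x ≤ 4 := max_le hx.le (by norm_num)
    have hmain : ‖∑' y, f (x - y) * (g y : ℂ) - A * ((∑' y, g y : ℝ) : ℂ) * ((jnorm x ^ (2 - (d : ℝ)) : ℝ) : ℂ)‖ ≤ D₀ := by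
      have h2 : ‖A * ((∑' y, g y : ℝ) : ℂ) * ((jnorm x ^ (2 - (d : ℝ)) : ℝ) : ℂ)‖ ≤ ‖A‖ * (C * Z₂) := by
        rw [norm_mul, norm_mul, Complex.norm_real, Complex.norm_real, Real.norm_eq_abs, Real.norm_eq_abs,
          abs_of_nonneg (Real.rpow_nonneg (jnorm_pos x).le _)]
        have hGabs : |∑' y, g y| ≤ C * Z₂ := by
          have := norm_tsum_le_tsum_norm (f := g) (by simpa using hgs)
          simp only [Real.norm_eq_abs] at this
          exact this.trans hG
        calc ‖A‖ * |∑' y, g y| * jnorm x ^ (2 - (d : ℝ)) ≤ ‖A‖ * (C * Z₂) * 1 :=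
              mul_le_mul (mul_le_mul_of_nonneg_left hGabs (norm_nonneg A)) (jnorm_rpow_two_sub_le_one hd2 x)
                (Real.rpow_nonneg (jnorm_pos x).le _) (by positivity)
          _ = _ := by ring
      calc _ ≤ ‖∑' y, f (x - y) * (g y : ℂ)‖ + ‖A * ((∑' y, g y : ℝ) : ℂ) * ((jnorm x ^ (2 - (d : ℝ)) : ℝ) : ℂ)‖ :=
            norm_sub_le _ _
        _ ≤ D₀ := add_le_add hconv_bd h2
    have hD₀0 : 0 ≤ D₀ := by positivity
    have hpow : 1 ≤ 4 ^ ((d : ℝ) - 2 + σ) * jnorm x ^ (-((d : ℝ) - 2 + σ)) := by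
      have h1 : (4 : ℝ) ^ (-((d : ℝ) - 2 + σ)) ≤ jnorm x ^ (-((d : ℝ) - 2 + σ)) :=
        Real.rpow_le_rpow_of_nonpos (jnorm_pos x) hjx4 (by linarith)
      calc (1 : ℝ) = 4 ^ ((d : ℝ) - 2 + σ) * 4 ^ (-((d : ℝ) - 2 + σ)) := by
            rw [← Real.rpow_add (by norm_num : (0 : ℝ) < 4), add_neg_cancel, Real.rpow_zero]
        _ ≤ 4 ^ ((d : ℝ) - 2 + σ) * jnorm x ^ (-((d : ℝ) - 2 + σ)) := by gcongr
    calc _ ≤ D₀ := hmain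
      _ ≤ D₀ * (4 ^ ((d : ℝ) - 2 + σ) * jnorm x ^ (-((d : ℝ) - 2 + σ))) := le_mul_of_one_le_right hD₀0 hpow
      _ = D₀ * 4 ^ ((d : ℝ) - 2 + σ) * jnorm x ^ (-((d : ℝ) - 2 + σ)) := by ring
      _ ≤ _ := mul_le_mul_of_nonneg_right (le_max_left _ _) (Real.rpow_nonneg (jnorm_pos x).le _)
  · -- large `x`: the decomposition `A · (main term) + (error term)`
    rw [not_lt] at hx
    have hex1 : 1 ≤ euclidNorm x := by linarith
    have hjx : jnorm x = euclidNorm x := jnorm_eq_euclidNorm hex1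
    obtain ⟨hMs, hM⟩ := abs_tsum_riesz_diff_mul_le hd hg hge hσ hσρ hσ1 hx
    obtain ⟨hEs, hE⟩ := norm_tsum_error_mul_le hd he hg hσ hσρ hσ1 hx
    -- summability of the pieces
    have hRs : Summable fun y => jnorm (x - y) ^ (2 - (d : ℝ)) * g y := by
      refine Summable.of_norm_bounded hgs fun y => ?_
      rw [Real.norm_eq_abs, abs_mul, abs_of_nonneg (Real.rpow_nonneg (jnorm_pos _).le _)]
      exact mul_le_of_le_one_left (abs_nonneg _) (jnorm_rpow_two_sub_le_one hd2 _)
    have hgsum : Summable g := by simpa using hgs.of_abs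
    -- the error series, reindexed
    have hE_eq : ∑' y, e (x - y) * (g y : ℂ) = ∑' z, e z * (g (x - z) : ℂ) := by
      rw [← (Equiv.subLeft x).tsum_eq (fun z => e z * (g (x - z) : ℂ))]
      refine tsum_congr fun y => ?_
      simp [Equiv.subLeft_apply]
    have hEs' : Summable fun y => e (x - y) * (g y : ℂ) := by
      have h := (Equiv.subLeft x).summable_iff.2 hEs
      refine h.congr fun y => ?_
      simp [Function.comp, Equiv.subLeft_apply]
    -- decomposition of the convolution
    have hdecomp : ∑' y, f (x - y) * (g y : ℂ) =
        A * ((∑' y, jnorm (x - y) ^ (2 - (d : ℝ)) * g y : ℝ) : ℂ) + ∑' y, e (x - y) * (g y : ℂ) := by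
      have hpt : ∀ y, f (x - y) * (g y : ℂ) =
          A * (((jnorm (x - y) ^ (2 - (d : ℝ)) * g y : ℝ) : ℂ)) + e (x - y) * (g y : ℂ) := by
        intro y; simp only [he_def]; push_cast; ring
      have h1 : Summable fun y => A * (((jnorm (x - y) ^ (2 - (d : ℝ)) * g y : ℝ) : ℂ)) :=
        (Complex.summable_ofReal.2 hRs).mul_left A
      rw [tsum_congr hpt, Summable.tsum_add h1 hEs', tsum_mul_left, Complex.ofReal_tsum]
    have hM_eq : ∑' y, (jnorm (x - y) ^ (2 - (d : ℝ)) - jnorm x ^ (2 - (d : ℝ))) * g y =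
        ∑' y, jnorm (x - y) ^ (2 - (d : ℝ)) * g y - (∑' y, g y) * jnorm x ^ (2 - (d : ℝ)) := by
      have hpt : ∀ y, (jnorm (x - y) ^ (2 - (d : ℝ)) - jnorm x ^ (2 - (d : ℝ))) * g y =
          jnorm (x - y) ^ (2 - (d : ℝ)) * g y - jnorm x ^ (2 - (d : ℝ)) * g y := fun y => by ring
      rw [tsum_congr hpt, Summable.tsum_sub hRs (hgsum.mul_left _), tsum_mul_left]; ring
    have hD : ∑' y, f (x - y) * (g y : ℂ) - A * ((∑' y, g y : ℝ) : ℂ) * ((jnorm x ^ (2 - (d : ℝ)) : ℝ) : ℂ) =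
        A * ((∑' y, (jnorm (x - y) ^ (2 - (d : ℝ)) - jnorm x ^ (2 - (d : ℝ))) * g y : ℝ) : ℂ) +
          ∑' z, e z * (g (x - z) : ℂ) := by
      rw [hdecomp, hM_eq, hE_eq]; push_cast; ring
    rw [hD]
    rw [← hjx] at hM hE
    calc ‖A * ((∑' y, (jnorm (x - y) ^ (2 - (d : ℝ)) - jnorm x ^ (2 - (d : ℝ))) * g y : ℝ) : ℂ) +
          ∑' z, e z * (g (x - z) : ℂ)‖
        ≤ ‖A * ((∑' y, (jnorm (x - y) ^ (2 - (d : ℝ)) - jnorm x ^ (2 - (d : ℝ))) * g y : ℝ) : ℂ)‖ +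
          ‖∑' z, e z * (g (x - z) : ℂ)‖ := norm_add_le _ _
      _ ≤ ‖A‖ * (KM * jnorm x ^ (-((d : ℝ) - 2 + σ))) + KE * jnorm x ^ (-((d : ℝ) - 2 + σ)) := by
          refine add_le_add ?_ hE
          rw [norm_mul, Complex.norm_real, Real.norm_eq_abs]
          exact mul_le_mul_of_nonneg_left hM (norm_nonneg A)
      _ = (‖A‖ * KM + KE) * jnorm x ^ (-((d : ℝ) - 2 + σ)) := by ring
      _ ≤ _ := mul_le_mul_of_nonneg_right (le_max_right _ _) (Real.rpow_nonneg (jnorm_pos x).le _)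

end Literature.Barriers.CriticalPhenomena
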